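import Summits.MatrixMultiplication.MatrixMultiplication.Theorems.SoloBlindConjETwoMain

/-!
# Conjecture E at corank two, in every rank (exponent three)

Sub-programme (K₃) / Conjecture E: `E(τ; S) = ∑_{T ⊆ S, ∑_T h = τ} 2^{-|T|} ≤ 1/2` for a zero-sum-free sequence
`h` over `𝔽₃` and an H-good target `τ` (no `T ⊆ S` with `∑_T h = τ + τ`).  `SoloBlindCorankOne` proved it at
corank one over any abelian group; here CORANK TWO in exponent `3`:

* `soloBlind_conjE_corank_two` — `G` of exponent `3`, `B` sum-distinct for `h`, `p ≠ q` outside `B` (values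
  unrestricted), `h` zero-sum free on `S = B ∪ {p, q}`, `τ` H-good on `S` ⟹ `E(τ; S) ≤ 1/2`.
* `soloBlind_conjE_basis_add_two` — the linear-independence form (sequences of length `≤ rank + 2`).

Proof.  Two deletions: `E = K_B(τ) + K_B(τ-a)/2 + K_B(τ-b)/2 + K_B(τ-a-b)/4` (`a = h p`, `b = h q`), each `K_B`
being `0` or `2^{-|A_C|}` for the unique representations `A₀, A₁, A₂, A₃ ⊆ B`.  H-goodness makes the
representations `A₀, A₁+p, A₂+q, A₃+p+q` of `τ` pairwise intersect, zero-sum-freeness makes them an antichain;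
the value configurations `|A₀| = 1`, `A₁ = ∅`, `A₂ = ∅` isolate a representation.  The heavy patterns are then
killed one by one — (`K-a`) `A₁ = A₂ = {s}`: `(A₀ \ s) + p + q` is a zero-sum; (`K-b`) `A₀ = {s, v}`, `A₁ = {s}`:
a zero-sum through `v` and `A₂`; (`K-c`) same with `A₃` (a zero-sum or a `τ + τ`-sum); (`Q1`, `Q2`) the pair and
twin configurations without `A₀` — and when all four representations are present the rigidity
`A₀ ∩ A₃ = A₁ ∩ A₂`, `A₀ ∆ A₃ = A₁ ∆ A₂` (`soloBlind_rep_rigidity`) forces `|A₀| ≥ 3, |A₁|, |A₂| ≥ 2, |A₃| ≥ 1`,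
i.e. total weight `≤ 1/2`.  (K3.29–K3.30: the type search proves corank `≤ 3`; this is the hand certificate for
corank `2`.)
-/

namespace Summit.MatrixMultiplication.MatrixMultiplication.Theorems

open Finset

universe u

variable {ι : Type*} [DecidableEq ι]
variable {G : Type u} [AddCommGroup G] [DecidableEq G]

/-- CONJECTURE E AT CORANK TWO (every rank; exponent `3`): for a sum-distinct `B`, `p ≠ q` outside `B`, `h`
zero-sum free on `B ∪ {p, q}` and `τ` H-good on `B ∪ {p, q}`, `E(τ; B ∪ {p, q}) ≤ 1/2`. -/
theorem soloBlind_conjE_corank_two (three : ∀ g : G, g + g + g = 0) {h : ι → G} {B : Finset ι} {p q : ι}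
    (hpB : p ∉ B) (hqB : q ∉ B) (hpq : p ≠ q)
    (hdist : ∀ A ⊆ B, ∀ A' ⊆ B, ∑ i ∈ A, h i = ∑ i ∈ A', h i → A = A')
    (zsf : ∀ T ⊆ insert q (insert p B), T.Nonempty → ∑ i ∈ T, h i ≠ 0) {τ : G}
    (hgood : ∀ T ⊆ insert q (insert p B), ∑ i ∈ T, h i ≠ τ + τ) :
    soloBlindMass h (insert q (insert p B)) τ ≤ 1 / 2 := by
  -- membership bookkeeping
  have hqS : q ∈ insert q (insert p B) := Finset.mem_insert_self q _
  have hpS : p ∈ insert q (insert p B) := Finset.mem_insert_of_mem (Finset.mem_insert_self p B)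
  have hBS : B ⊆ insert q (insert p B) := (Finset.subset_insert p B).trans (Finset.subset_insert q _)
  have hq' : q ∉ insert p B := by
    intro hq
    rcases Finset.mem_insert.mp hq with hq | hq
    · exact hpq hq.symm
    · exact hqB hq
  -- two deletions
  rw [soloBlind_mass_erase h hqS τ, Finset.erase_insert hq', soloBlind_mass_erase h (Finset.mem_insert_self p B) τ,
    soloBlind_mass_erase h (Finset.mem_insert_self p B) (τ - h q), Finset.erase_insert hpB]
  -- generic bounds
  have m0 := soloBlind_mass_le_one_of_sumDistinct hdist τ
  have m1 := soloBlind_mass_le_one_of_sumDistinct hdist (τ - h p)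
  have m2 := soloBlind_mass_le_one_of_sumDistinct hdist (τ - h q)
  have m3 := soloBlind_mass_le_one_of_sumDistinct hdist (τ - h q - h p)
  have z0 := soloBlind_mass_nonneg h B τ
  have z1 := soloBlind_mass_nonneg h B (τ - h p)
  have z2 := soloBlind_mass_nonneg h B (τ - h q)
  have z3 := soloBlind_mass_nonneg h B (τ - h q - h p)
  have rep : ∀ {x : G} {A : Finset ι}, A ∈ soloBlindSeqRepAll h B x → A ⊆ B ∧ ∑ i ∈ A, h i = x :=
    fun hA => soloBlind_mem_seqRepAll.mp hA
  have e12 : τ - h p + (τ - h q) + h p + h q = τ + τ := by abel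
  -- singleton representations: `A = {s}` from `|A| = 1`
  have single : ∀ {A : Finset ι} {x : G}, A ⊆ B → ∑ i ∈ A, h i = x → A.card = 1 →
      ∃ s, A = {s} ∧ s ∈ B ∧ h s = x := by
    intro A x hAB hAs h1
    obtain ⟨s, rfl⟩ := Finset.card_eq_one.mp h1
    rw [Finset.sum_singleton] at hAs
    exact ⟨s, rfl, hAB (Finset.mem_singleton_self s), hAs⟩
  -- the case analysis
  rcases (soloBlindSeqRepAll h B τ).eq_empty_or_nonempty with hR0 | ⟨A₀, hA₀⟩
  · ---------------------------------------------------------------- (C0) `A₀` absent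
    rw [soloBlind_mass_eq_zero_of_repAll_eq_empty hR0]
    rcases (soloBlindSeqRepAll h B (τ - h p)).eq_empty_or_nonempty with hR1 | ⟨A₁, hA₁⟩
    · rw [soloBlind_mass_eq_zero_of_repAll_eq_empty hR1]
      rcases (soloBlindSeqRepAll h B (τ - h q)).eq_empty_or_nonempty with hR2 | ⟨A₂, hA₂⟩
      · rw [soloBlind_mass_eq_zero_of_repAll_eq_empty hR2]
        linarith
      · obtain ⟨hA₂B, hA₂s⟩ := rep hA₂
        rcases Nat.eq_zero_or_pos A₂.card with n20 | n2pos
        · -- `τ = b`: `A₃` is absent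
          rw [Finset.card_eq_zero] at n20
          rw [n20, Finset.sum_empty] at hA₂s
          have hR3 : soloBlindSeqRepAll h B (τ - h q - h p) = ∅ := by
            rw [Finset.eq_empty_iff_forall_notMem]
            intro T hT
            obtain ⟨hTB, hTs⟩ := rep hT
            refine soloBlind_kill_one zsf hBS hpS hpB hTB ?_
            rw [hTs, ← hA₂s]
            abel
          rw [soloBlind_mass_eq_zero_of_repAll_eq_empty hR3]
          linarith
        · have m2' := soloBlind_mass_le_pow_of_rep hdist hA₂ n2pos
          rw [pow_one] at m2'
          linarith
    · obtain ⟨hA₁B, hA₁s⟩ := rep hA₁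
      rcases Nat.eq_zero_or_pos A₁.card with n10 | n1pos
      · -- `τ = a`: `A₂` (H-good) and `A₃` (zero-sum) are absent
        rw [Finset.card_eq_zero] at n10
        rw [n10, Finset.sum_empty] at hA₁s
        have hR2 : soloBlindSeqRepAll h B (τ - h q) = ∅ := by
          rw [Finset.eq_empty_iff_forall_notMem]
          intro T hT
          obtain ⟨hTB, hTs⟩ := rep hT
          refine soloBlind_hgood_two hgood hBS hpS hqS hpB hqB hpq hTB ?_
          rw [hTs]
          have e : τ = h p := (sub_eq_zero.mp hA₁s.symm)
          rw [e]
          abel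
        have hR3 : soloBlindSeqRepAll h B (τ - h q - h p) = ∅ := by
          rw [Finset.eq_empty_iff_forall_notMem]
          intro T hT
          obtain ⟨hTB, hTs⟩ := rep hT
          refine soloBlind_kill_one zsf hBS hqS hqB hTB ?_
          rw [hTs, (sub_eq_zero.mp hA₁s.symm : τ = h p)]
          abel
        rw [soloBlind_mass_eq_zero_of_repAll_eq_empty hR2, soloBlind_mass_eq_zero_of_repAll_eq_empty hR3]
        linarith
      · have m1' := soloBlind_mass_le_pow_of_rep hdist hA₁ n1pos
        rw [pow_one] at m1'
        rcases (soloBlindSeqRepAll h B (τ - h q)).eq_empty_or_nonempty with hR2 | ⟨A₂, hA₂⟩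
        · rw [soloBlind_mass_eq_zero_of_repAll_eq_empty hR2]
          linarith
        · obtain ⟨hA₂B, hA₂s⟩ := rep hA₂
          rcases Nat.eq_zero_or_pos A₂.card with n20 | n2pos
          · -- `τ = b` contradicts the presence of `A₁` (H-good)
            exfalso
            rw [Finset.card_eq_zero] at n20
            rw [n20, Finset.sum_empty] at hA₂s
            refine soloBlind_hgood_two hgood hBS hpS hqS hpB hqB hpq hA₁B ?_
            rw [hA₁s]
            have e : τ = h q := (sub_eq_zero.mp hA₂s.symm)
            rw [e]
            abel
          · have m2' := soloBlind_mass_le_pow_of_rep hdist hA₂ n2pos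
            rw [pow_one] at m2'
            obtain ⟨s, hs₁, hs₂⟩ := soloBlind_reps_meet_two hgood hBS hpS hqS hpB hqB hpq e12 hA₁ hA₂
            rcases (soloBlindSeqRepAll h B (τ - h q - h p)).eq_empty_or_nonempty with hR3 | ⟨A₃, hA₃⟩
            · rw [soloBlind_mass_eq_zero_of_repAll_eq_empty hR3]
              linarith
            · obtain ⟨hA₃B, hA₃s⟩ := rep hA₃
              rcases Nat.lt_or_ge A₁.card 2 with n1lt | n1ge
              · -- `A₁ = {s}`, `h s = τ - a`
                obtain ⟨s', hA₁e, -, hss⟩ := single hA₁B hA₁s (by omega)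
                have hs' : s = s' := by rw [hA₁e] at hs₁; exact Finset.mem_singleton.mp hs₁
                subst hs'
                rcases Nat.lt_or_ge A₂.card 2 with n2lt | n2ge
                · -- (Q2) `A₂ = {s}` too: `a = b`; `A₃` through `s` is a zero-sum, avoiding `s` a `τ + τ`-sum
                  exfalso
                  obtain ⟨s'', hA₂e, -, hss'⟩ := single hA₂B hA₂s (by omega)
                  have hs'' : s = s'' := by rw [hA₂e] at hs₂; exact Finset.mem_singleton.mp hs₂
                  subst hs''
                  by_cases hsA₃ : s ∈ A₃
                  · refine soloBlind_kill_one zsf hBS hqS hqB ((Finset.erase_subset s A₃).trans hA₃B) ?_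
                    rw [Finset.sum_erase_eq_sub hsA₃, hA₃s, hss]
                    abel
                  · refine soloBlind_hgood_zero hgood hBS (Finset.insert_subset (hA₁B hs₁) hA₃B) ?_
                    rw [Finset.sum_insert hsA₃, hA₃s]
                    have eab : h p = h q := by
                      have := hss.symm.trans hss'
                      simpa using this
                    have t := three (h p)
                    rw [hss, ← eab]
                    calc τ - h p + (τ - h p - h p) = τ + τ - (h p + h p + h p) := by abel
                      _ = τ + τ := by rw [t, sub_zero]
                · -- `|A₂| ≥ 2`
                  have m2'' := soloBlind_mass_le_pow_of_rep hdist hA₂ (n := 2) n2ge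
                  norm_num at m2''
                  rcases Nat.eq_zero_or_pos A₃.card with n30 | n3pos
                  · -- (Q1) `τ = a + b`, `h s = b`: `(A₂ \ s) + p` sums to `τ + τ`
                    exfalso
                    rw [Finset.card_eq_zero] at n30
                    rw [n30, Finset.sum_empty] at hA₃s
                    refine soloBlind_hgood_one hgood hBS hpS hpB ((Finset.erase_subset s A₂).trans hA₂B) ?_
                    rw [Finset.sum_erase_eq_sub hs₂, hA₂s, hss]
                    have e : τ = h p + h q := by
                      have := sub_eq_zero.mp hA₃s.symm
                      rw [sub_eq_iff_eq_add] at this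
                      exact this
                    have t := three (h q)
                    calc τ - h q - (τ - h p) + h p = τ + τ - (h q + h q + h q) := by rw [e]; abel
                      _ = τ + τ := by rw [t, sub_zero]
                  · have m3' := soloBlind_mass_le_pow_of_rep hdist hA₃ n3pos
                    rw [pow_one] at m3'
                    linarith
              · have m1'' := soloBlind_mass_le_pow_of_rep hdist hA₁ (n := 2) n1ge
                norm_num at m1''
                rcases Nat.lt_or_ge A₂.card 2 with n2lt | n2ge
                · -- `A₂ = {s}`, `h s = τ - b`
                  obtain ⟨s', hA₂e, -, hss⟩ := single hA₂B hA₂s (by omega)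
                  have hs' : s = s' := by rw [hA₂e] at hs₂; exact Finset.mem_singleton.mp hs₂
                  subst hs'
                  rcases Nat.eq_zero_or_pos A₃.card with n30 | n3pos
                  · -- (Q1') `τ = a + b`, `h s = a`: `(A₁ \ s) + q` sums to `τ + τ`
                    exfalso
                    rw [Finset.card_eq_zero] at n30
                    rw [n30, Finset.sum_empty] at hA₃s
                    refine soloBlind_hgood_one hgood hBS hqS hqB ((Finset.erase_subset s A₁).trans hA₁B) ?_
                    rw [Finset.sum_erase_eq_sub hs₁, hA₁s, hss]
                    have e : τ = h p + h q := by
                      have := sub_eq_zero.mp hA₃s.symm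
                      rw [sub_eq_iff_eq_add] at this
                      exact this
                    have t := three (h p)
                    calc τ - h p - (τ - h q) + h q = τ + τ - (h p + h p + h p) := by rw [e]; abel
                      _ = τ + τ := by rw [t, sub_zero]
                  · have m3' := soloBlind_mass_le_pow_of_rep hdist hA₃ n3pos
                    rw [pow_one] at m3'
                    linarith
                · have m2'' := soloBlind_mass_le_pow_of_rep hdist hA₂ (n := 2) n2ge
                  norm_num at m2''
                  linarith
  · ---------------------------------------------------------------- (C1) `A₀` present
    obtain ⟨hA₀B, hA₀s⟩ := rep hA₀
    rcases Nat.eq_zero_or_pos A₀.card with n00 | n0pos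
    · -- `τ = 0` is not H-good
      exfalso
      rw [Finset.card_eq_zero] at n00
      rw [n00, Finset.sum_empty] at hA₀s
      exact soloBlind_hgood_zero hgood hBS (Finset.empty_subset B) (by rw [Finset.sum_empty, ← hA₀s, add_zero])
    rcases Nat.lt_or_ge A₀.card 2 with n0lt | n0ge
    · -- `A₀ = {s₀}`, `h s₀ = τ`: every other representation is killed
      obtain ⟨s₀, hA₀e, hs₀B, hs₀⟩ := single hA₀B hA₀s (by omega)
      have m0' := soloBlind_mass_le_pow_of_rep hdist hA₀ (n := 1) n0pos
      rw [pow_one] at m0'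
      have hR1 : soloBlindSeqRepAll h B (τ - h p) = ∅ := by
        rw [Finset.eq_empty_iff_forall_notMem]
        intro T hT
        obtain ⟨hTB, hTs⟩ := rep hT
        by_cases h0 : s₀ ∈ T
        · refine soloBlind_kill_one zsf hBS hpS hpB ((Finset.erase_subset s₀ T).trans hTB) ?_
          rw [Finset.sum_erase_eq_sub h0, hTs, hs₀]
          abel
        · refine soloBlind_hgood_one hgood hBS hpS hpB (Finset.insert_subset hs₀B hTB) ?_
          rw [Finset.sum_insert h0, hTs, hs₀]
          abel
      have hR2 : soloBlindSeqRepAll h B (τ - h q) = ∅ := by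
        rw [Finset.eq_empty_iff_forall_notMem]
        intro T hT
        obtain ⟨hTB, hTs⟩ := rep hT
        by_cases h0 : s₀ ∈ T
        · refine soloBlind_kill_one zsf hBS hqS hqB ((Finset.erase_subset s₀ T).trans hTB) ?_
          rw [Finset.sum_erase_eq_sub h0, hTs, hs₀]
          abel
        · refine soloBlind_hgood_one hgood hBS hqS hqB (Finset.insert_subset hs₀B hTB) ?_
          rw [Finset.sum_insert h0, hTs, hs₀]
          abel
      have hR3 : soloBlindSeqRepAll h B (τ - h q - h p) = ∅ := by
        rw [Finset.eq_empty_iff_forall_notMem]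
        intro T hT
        obtain ⟨hTB, hTs⟩ := rep hT
        by_cases h0 : s₀ ∈ T
        · refine soloBlind_kill_two zsf hBS hpS hqS hpB hqB hpq ((Finset.erase_subset s₀ T).trans hTB) ?_
          rw [Finset.sum_erase_eq_sub h0, hTs, hs₀]
          abel
        · refine soloBlind_hgood_two hgood hBS hpS hqS hpB hqB hpq (Finset.insert_subset hs₀B hTB) ?_
          rw [Finset.sum_insert h0, hTs, hs₀]
          abel
      rw [soloBlind_mass_eq_zero_of_repAll_eq_empty hR1, soloBlind_mass_eq_zero_of_repAll_eq_empty hR2,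
        soloBlind_mass_eq_zero_of_repAll_eq_empty hR3]
      linarith
    · -- `|A₀| ≥ 2`
      have m0' := soloBlind_mass_le_pow_of_rep hdist hA₀ (n := 2) n0ge
      norm_num at m0'
      exact soloBlind_conjE_corank_two_main three hpB hqB hpq hdist zsf hgood hA₀ n0ge

section LinearIndependence

variable {R : Type*} [Ring R] [Nontrivial R] [Module R G]

/-- CONJECTURE E FOR SEQUENCES OF LENGTH `≤ rank + 2`, EVERY RANK (exponent `3`): if `h` is linearly independent
on `B` (elementary form), `p ≠ q` lie outside `B`, `h` is zero-sum free on `B ∪ {p, q}` and `τ` is H-good there,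
then `E(τ; B ∪ {p, q}) ≤ 1/2`. -/
theorem soloBlind_conjE_basis_add_two (three : ∀ g : G, g + g + g = 0) {h : ι → G} {B : Finset ι} {p q : ι}
    (hpB : p ∉ B) (hqB : q ∉ B) (hpq : p ≠ q)
    (hli : ∀ g : ι → R, ∑ i ∈ B, g i • h i = 0 → ∀ i ∈ B, g i = 0)
    (zsf : ∀ T ⊆ insert q (insert p B), T.Nonempty → ∑ i ∈ T, h i ≠ 0) {τ : G}
    (hgood : ∀ T ⊆ insert q (insert p B), ∑ i ∈ T, h i ≠ τ + τ) :
    soloBlindMass h (insert q (insert p B)) τ ≤ 1 / 2 :=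
  soloBlind_conjE_corank_two three hpB hqB hpq (soloBlind_sumDistinct_of_linearIndependent (R := R) hli) zsf hgood

end LinearIndependence

end Summit.MatrixMultiplication.MatrixMultiplication.Theorems
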